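import Summits.ResolutionOfSingularities.ResolutionOfSingularities.Theorems.HilbertSamuelEliminationSigmaMaxModificationsCorridor3WLadderRecognitionNearLocusCurve
import Literature.AlgebraicGeometry.Resolution.PointCentrePermissible
import Literature.AlgebraicGeometry.CossartJannsenSaito2020.DirectrixSemicontinuity
import HarnessLib

/-!
# [OURS · L1 W4.2] RECOGNITION-GEOMETRY (R2), PART 3: THE FINITE CASE and THE DICHOTOMY (G1) «finitely many closed points, or a
# curve `⥲ C_j`» for the near locus over a curve centre (crux chain w42, line `w_ladder`; `--supports stmt-…-19249`, helper)

OURS (cell res-hironaka, slot W4.2, seat res-L1-w42-stub-2 gen 4); NOT statements of H. Hironaka's manuscript [Hironaka2017]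
nor of [CossartJannsenSaito2020]. AI-drafted, weaker than expert review. Sorry-free PROOF file (no new definition).

Continuation of `…WLadderRecognitionNearLocusFibres` / `…Curve` (same standing hypotheses). CJS p. 94: «Hence `D′` is a collection
of closed points or a regular irreducible curve»; Def. 6.38 (v): «`π_m : C_m → C_{m−1}` is not surjective». FINITE CASE = the
generic point `η_j` of `C_j` is NOT in `π_{j+1}(N_{j+1}(x))`:

* `not_subset_image_nearLocus_succ_of_not_dominant` — clause (v) of Def. 6.38 verbatim: `¬ (C_j ⊆ π_{j+1}(N_{j+1}(x)))`;
* `isClosed_singleton_of_mem_nearLocus_succ_of_not_dominant`, `finite_nearLocus_succ_of_not_dominant` (over a NOETHERIAN `X_0`),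
  `exists_isOpen_inter_nearLocus_succ_eq_singleton_of_not_dominant` — `N_{j+1}(x)` is a finite set of closed points, each ISOLATED in it;
* (G2) `isRegular_point_of_mem_nearLocus_succ_of_not_dominant` — each of them is a regular reduced point;
* **(G1) `nearLocus_succ_shape`** — the dichotomy in one statement (for stub-1's (R5)/(H-emp)), `nearLocus_succ_finite_or_dominant`,
  and `dominant_of_not_isolated` (a non-isolated near point — e.g. the marked point at an interior stage of a unit — forces the
  dominant case); `not_dominant_of_isolated_closed` / **`not_subset_image_nearLocus_succ_of_isolated_closed`** (an ISOLATED closed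
  near point — the marked point at an `Iso` stage — forces the finite case, hence Def. 6.38 (v));
* **ALONG THE UNIT**: `curveData_of_centres_eq_nearLocus` (if `C_0 = {x}`, `C_i = N_i(x)` for `1 ≤ i ≤ q`, `C_1` is a curve and the
  marked-point-type witnesses at stages `2 ≤ i ≤ q` are not isolated, then every `C_i` is a curve) and
  **`inducesIsoOn_of_centres_eq_nearLocus`** — CJS Def. 6.38 (iv) `C_{j+1} ⥲ C_j` for all `1 ≤ j`, `j + 1 ≤ q` (the `iso` clause of
  `IsFundamentalUnit` / `Seg.UnitCentreDiscipline`, binder `hPb` as in PART 2).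

BINDERS: printed facts BY NAME — h3104 `CossartJannsenSaito2020_thm_3_10_4`, h314f `Thm314_nearFibre_subsingleton`, and
`hT36 : CossartJannsenSaito2020_thm_3_6` (F-65, `DirectrixSemicontinuity.lean`; PARTS 1/2 take the same statement unfolded, so `hT36`
is passed to them verbatim).

## References

* V. Cossart, U. Jannsen, S. Saito, LNM 2270 (2020): Thm. 3.14, Def. 6.38 (iii)–(v), proof of Thm. 6.28 Step 2 (p. 94), pp. 104–105.
  [CossartJannsenSaito2020]
-/

noncomputable section

-- namespace `…Corridor3.Helpers` re-enters `…Corridor3`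
set_option linter.dupNamespace false

open CategoryTheory AlgebraicGeometry TopologicalSpace IsLocalRing
open Literature.AlgebraicGeometry.Resolution
open Scheme.IdealSheafData

universe u

open Literature.AlgebraicGeometry.CossartJannsenSaito2020

namespace Summit.ResolutionOfSingularities.ResolutionOfSingularities.Theorems.SigmaMaxModificationsCorridor3.Helpers

namespace BlowupTowerNear

variable {T : BlowupTower.{u}} {N : ℕ}

/-! ## The FINITE case -/

/-- **FINITE CASE: if the generic point of `C_j` is NOT hit, clause (v) of CJS Def. 6.38 holds verbatim: `¬ (C_j ⊆ π_{j+1}(N_{j+1}(x)))`.**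
[cite: CossartJannsenSaito2020, Def. 6.38 (v)] -/
theorem not_subset_image_nearLocus_succ_of_not_dominant {x : T.X 0} {j : ℕ} {η : T.X j} (hη : IsGenericPoint η (T.C j))
    (hfin : η ∉ (T.π j).base '' T.nearLocus N x (j + 1)) : ¬ (T.C j ⊆ (T.π j).base '' T.nearLocus N x (j + 1)) :=
  fun h => hfin (h hη.mem)

/-- **FINITE CASE: every point of `N_{j+1}(x)` is CLOSED.** [cite: CossartJannsenSaito2020, p. 94] -/
theorem isClosed_singleton_of_mem_nearLocus_succ_of_not_dominant (h314f : Thm314_nearFibre_subsingleton.{u})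
    (hT36 : CossartJannsenSaito2020_thm_3_6.{u})
    (h3104 : CossartJannsenSaito2020_thm_3_10_4.{u}) (hkey : KeySetting T N)
    (hperm : ∀ j, IdealSheafData.IsPermissible (T.centreIdeal j))
    (hcl : ∀ (j : ℕ) (μ : ℕ → ℕ), IsClosed (Scheme.hsStratumGE (T.X j) N μ))
    {x : T.X 0} (hx : IsClosed ({x} : Set (T.X 0))) (hchar : CharHypothesis (T.X 0) x) (hē : T.geomDirDimAt 0 x ≤ 2) {j : ℕ}
    (hNC : ∀ i, i ≤ j → T.nearLocus N x i ⊆ T.C i) (hCN : T.C j ⊆ T.nearLocus N x j)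
    (hirr : IsIrreducible (T.C j)) (hnt : (T.C j).Nontrivial)
    (hpts : ∀ y ∈ T.C j, ¬ IsGenericPoint y (T.C j) → IsClosed ({y} : Set (T.X j)))
    {η : T.X j} (hη : IsGenericPoint η (T.C j)) (hfin : η ∉ (T.π j).base '' T.nearLocus N x (j + 1)) :
    ∀ z ∈ T.nearLocus N x (j + 1), IsClosed ({z} : Set (T.X (j + 1))) :=
  fun z hz => isClosed_singleton_of_mem_nearLocus_succ h314f hT36 h3104 hkey hperm hcl hx hchar hē hNC hCN hirr hnt hpts hz
    (fun h => hfin ⟨z, hz, h.eq hη⟩)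

/-- **FINITE CASE: `N_{j+1}(x)` is a FINITE set** (a closed subset of a noetherian stage all of whose points are closed).
[cite: CossartJannsenSaito2020, p. 94] -/
theorem finite_nearLocus_succ_of_not_dominant [IsNoetherian (T.X 0)] (h314f : Thm314_nearFibre_subsingleton.{u})
    (hT36 : CossartJannsenSaito2020_thm_3_6.{u})
    (h3104 : CossartJannsenSaito2020_thm_3_10_4.{u}) (hkey : KeySetting T N)
    (hperm : ∀ j, IdealSheafData.IsPermissible (T.centreIdeal j))
    (hcl : ∀ (j : ℕ) (μ : ℕ → ℕ), IsClosed (Scheme.hsStratumGE (T.X j) N μ))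
    {x : T.X 0} (hx : IsClosed ({x} : Set (T.X 0))) (hchar : CharHypothesis (T.X 0) x) (hē : T.geomDirDimAt 0 x ≤ 2) {j : ℕ}
    (hNC : ∀ i, i ≤ j → T.nearLocus N x i ⊆ T.C i) (hCN : T.C j ⊆ T.nearLocus N x j)
    (hirr : IsIrreducible (T.C j)) (hnt : (T.C j).Nontrivial)
    (hpts : ∀ y ∈ T.C j, ¬ IsGenericPoint y (T.C j) → IsClosed ({y} : Set (T.X j)))
    {η : T.X j} (hη : IsGenericPoint η (T.C j)) (hfin : η ∉ (T.π j).base '' T.nearLocus N x (j + 1)) :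
    (T.nearLocus N x (j + 1)).Finite := by
  haveI : IsNoetherian (T.X (j + 1)) := isNoetherian T (j + 1)
  have hN : IsClosed (T.nearLocus N x (j + 1)) := isClosed_nearLocus T hkey hperm hcl hx (j + 1)
  have hzcl := isClosed_singleton_of_mem_nearLocus_succ_of_not_dominant h314f hT36 h3104 hkey hperm hcl hx hchar hē hNC hCN hirr
    hnt hpts hη hfin
  obtain ⟨S, hSfin, hScl, hSirr, hS⟩ := NoetherianSpace.exists_finite_set_isClosed_irreducible hN
  have hsing : ∀ t ∈ S, ∃ z : T.X (j + 1), t = {z} := by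
    intro t ht
    have hζ : IsGenericPoint (hSirr t ht).genericPoint t := (hSirr t ht).isGenericPoint_genericPoint (hScl t ht)
    have hζN : (hSirr t ht).genericPoint ∈ T.nearLocus N x (j + 1) := by
      rw [hS]; exact Set.mem_sUnion_of_mem hζ.mem ht
    refine ⟨(hSirr t ht).genericPoint, ?_⟩
    have h1 : closure {(hSirr t ht).genericPoint} = t := hζ.def
    rw [(hzcl _ hζN).closure_eq] at h1
    exact h1.symm
  rw [hS]
  refine Set.Finite.sUnion hSfin fun t ht => ?_
  obtain ⟨z, rfl⟩ := hsing t ht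
  exact Set.finite_singleton z

/-- **FINITE CASE: every point of `N_{j+1}(x)` is ISOLATED in it** — in particular the marked point of the chain is isolated in its
near locus (the `Iso` reading of the end of a fundamental unit). [cite: CossartJannsenSaito2020, Def. 6.38 (v), p. 105] -/
theorem exists_isOpen_inter_nearLocus_succ_eq_singleton_of_not_dominant [IsNoetherian (T.X 0)] (h314f : Thm314_nearFibre_subsingleton.{u})
    (hT36 : CossartJannsenSaito2020_thm_3_6.{u})
    (h3104 : CossartJannsenSaito2020_thm_3_10_4.{u}) (hkey : KeySetting T N)
    (hperm : ∀ j, IdealSheafData.IsPermissible (T.centreIdeal j))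
    (hcl : ∀ (j : ℕ) (μ : ℕ → ℕ), IsClosed (Scheme.hsStratumGE (T.X j) N μ))
    {x : T.X 0} (hx : IsClosed ({x} : Set (T.X 0))) (hchar : CharHypothesis (T.X 0) x) (hē : T.geomDirDimAt 0 x ≤ 2) {j : ℕ}
    (hNC : ∀ i, i ≤ j → T.nearLocus N x i ⊆ T.C i) (hCN : T.C j ⊆ T.nearLocus N x j)
    (hirr : IsIrreducible (T.C j)) (hnt : (T.C j).Nontrivial)
    (hpts : ∀ y ∈ T.C j, ¬ IsGenericPoint y (T.C j) → IsClosed ({y} : Set (T.X j)))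
    {η : T.X j} (hη : IsGenericPoint η (T.C j)) (hfin : η ∉ (T.π j).base '' T.nearLocus N x (j + 1)) :
    ∀ z ∈ T.nearLocus N x (j + 1), ∃ U : Set (T.X (j + 1)), IsOpen U ∧ U ∩ T.nearLocus N x (j + 1) = {z} := by
  intro z hz
  have hF := finite_nearLocus_succ_of_not_dominant h314f hT36 h3104 hkey hperm hcl hx hchar hē hNC hCN hirr hnt hpts hη hfin
  have hzcl := isClosed_singleton_of_mem_nearLocus_succ_of_not_dominant h314f hT36 h3104 hkey hperm hcl hx hchar hē hNC hCN hirr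
    hnt hpts hη hfin
  have hrest : IsClosed (⋃ w ∈ T.nearLocus N x (j + 1) \ {z}, ({w} : Set (T.X (j + 1)))) :=
    (hF.subset fun _ hw => hw.1).isClosed_biUnion fun w hw => hzcl w hw.1
  refine ⟨(⋃ w ∈ T.nearLocus N x (j + 1) \ {z}, ({w} : Set (T.X (j + 1))))ᶜ, hrest.isOpen_compl, ?_⟩
  ext w
  simp only [Set.mem_inter_iff, Set.mem_compl_iff, Set.mem_iUnion, Set.mem_singleton_iff, exists_prop, not_exists, not_and]
  constructor
  · rintro ⟨h1, h2⟩
    by_contra hne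
    exact h1 w ⟨h2, hne⟩ rfl
  · rintro rfl
    exact ⟨fun v hv hwv => hv.2 hwv.symm, hz⟩

/-- **THE DICHOTOMY (G1): `N_{j+1}(x)` is FINITE, or it DOMINATES `C_j`** (and then it is an irreducible curve mapped isomorphically
onto `C_j`, see the `_of_dominant` family). [cite: CossartJannsenSaito2020, p. 94, p. 104] -/
theorem nearLocus_succ_finite_or_dominant [IsNoetherian (T.X 0)] (h314f : Thm314_nearFibre_subsingleton.{u})
    (hT36 : CossartJannsenSaito2020_thm_3_6.{u})
    (h3104 : CossartJannsenSaito2020_thm_3_10_4.{u}) (hkey : KeySetting T N)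
    (hperm : ∀ j, IdealSheafData.IsPermissible (T.centreIdeal j))
    (hcl : ∀ (j : ℕ) (μ : ℕ → ℕ), IsClosed (Scheme.hsStratumGE (T.X j) N μ))
    {x : T.X 0} (hx : IsClosed ({x} : Set (T.X 0))) (hchar : CharHypothesis (T.X 0) x) (hē : T.geomDirDimAt 0 x ≤ 2) {j : ℕ}
    (hNC : ∀ i, i ≤ j → T.nearLocus N x i ⊆ T.C i) (hCN : T.C j ⊆ T.nearLocus N x j)
    (hirr : IsIrreducible (T.C j)) (hnt : (T.C j).Nontrivial)
    (hpts : ∀ y ∈ T.C j, ¬ IsGenericPoint y (T.C j) → IsClosed ({y} : Set (T.X j)))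
    {η : T.X j} (hη : IsGenericPoint η (T.C j)) :
    (T.nearLocus N x (j + 1)).Finite ∨ η ∈ (T.π j).base '' T.nearLocus N x (j + 1) := by
  by_cases hdom : η ∈ (T.π j).base '' T.nearLocus N x (j + 1)
  · exact Or.inr hdom
  · exact Or.inl (finite_nearLocus_succ_of_not_dominant h314f hT36 h3104 hkey hperm hcl hx hchar hē hNC hCN hirr hnt hpts hη hdom)

/-! ## (G1)/(G2) packaged for the label side (stub-1's (R5)/(H-emp)) -/

/-- **(G2), FINITE CASE: every point of `N_{j+1}(x)` is a closed point whose reduced point subscheme is REGULAR** (so any class of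
them is a disjoint union of regular points; a closed point is a permissible centre iff it is not a component,
`isPermissible_vanishingIdeal_singleton_iff`). [cite: CossartJannsenSaito2020, p. 94] -/
theorem isRegular_point_of_mem_nearLocus_succ_of_not_dominant (h314f : Thm314_nearFibre_subsingleton.{u})
    (hT36 : CossartJannsenSaito2020_thm_3_6.{u})
    (h3104 : CossartJannsenSaito2020_thm_3_10_4.{u}) (hkey : KeySetting T N)
    (hperm : ∀ j, IdealSheafData.IsPermissible (T.centreIdeal j))
    (hcl : ∀ (j : ℕ) (μ : ℕ → ℕ), IsClosed (Scheme.hsStratumGE (T.X j) N μ))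
    {x : T.X 0} (hx : IsClosed ({x} : Set (T.X 0))) (hchar : CharHypothesis (T.X 0) x) (hē : T.geomDirDimAt 0 x ≤ 2) {j : ℕ}
    (hNC : ∀ i, i ≤ j → T.nearLocus N x i ⊆ T.C i) (hCN : T.C j ⊆ T.nearLocus N x j)
    (hirr : IsIrreducible (T.C j)) (hnt : (T.C j).Nontrivial)
    (hpts : ∀ y ∈ T.C j, ¬ IsGenericPoint y (T.C j) → IsClosed ({y} : Set (T.X j)))
    {η : T.X j} (hη : IsGenericPoint η (T.C j)) (hfin : η ∉ (T.π j).base '' T.nearLocus N x (j + 1))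
    {z : T.X (j + 1)} (hz : z ∈ T.nearLocus N x (j + 1)) :
    ∃ hzcl : IsClosed ({z} : Set (T.X (j + 1))),
      Scheme.IsRegular (vanishingIdeal (⟨{z}, hzcl⟩ : Closeds (T.X (j + 1)))).subscheme := by
  haveI : ∀ j, IsLocallyNoetherian (T.X j) := T.ln
  have hzcl := isClosed_singleton_of_mem_nearLocus_succ_of_not_dominant h314f hT36 h3104 hkey hperm hcl hx hchar hē hNC hCN hirr hnt hpts hη hfin z hz
  exact ⟨hzcl, isRegular_subscheme_vanishingIdeal_singleton hzcl⟩

/-- **(G1) IN ONE STATEMENT — the SHAPE of the near locus over a curve centre.** Under the hypotheses of §2 at stage `j`, EITHER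
`N_{j+1}(x)` is a finite set of closed points, each isolated in it, not covering `C_j` (CJS Def. 6.38 (v): the unit ENDS), OR
`π_{j+1}` maps `N_{j+1}(x)` bijectively onto `C_j` and `N_{j+1}(x)` is a closed irreducible positive-dimensional set whose non-generic
points are closed (the unit CONTINUES with `C_{j+1} = N_{j+1}(x) ⥲ C_j`, `inducesIsoOn_nearLocus_succ_of_dominant`, and the
hypotheses reproduce at stage `j + 1`). [cite: CossartJannsenSaito2020, Def. 6.38 (iii)–(v), p. 94, p. 104] -/
theorem nearLocus_succ_shape [IsNoetherian (T.X 0)] (h314f : Thm314_nearFibre_subsingleton.{u})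
    (hT36 : CossartJannsenSaito2020_thm_3_6.{u})
    (h3104 : CossartJannsenSaito2020_thm_3_10_4.{u}) (hkey : KeySetting T N)
    (hperm : ∀ j, IdealSheafData.IsPermissible (T.centreIdeal j))
    (hcl : ∀ (j : ℕ) (μ : ℕ → ℕ), IsClosed (Scheme.hsStratumGE (T.X j) N μ))
    {x : T.X 0} (hx : IsClosed ({x} : Set (T.X 0))) (hchar : CharHypothesis (T.X 0) x) (hē : T.geomDirDimAt 0 x ≤ 2) {j : ℕ}
    (hNC : ∀ i, i ≤ j → T.nearLocus N x i ⊆ T.C i) (hCN : T.C j ⊆ T.nearLocus N x j)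
    (hirr : IsIrreducible (T.C j)) (hnt : (T.C j).Nontrivial)
    (hpts : ∀ y ∈ T.C j, ¬ IsGenericPoint y (T.C j) → IsClosed ({y} : Set (T.X j)))
    {η : T.X j} (hη : IsGenericPoint η (T.C j)) :
    ((T.nearLocus N x (j + 1)).Finite ∧
        (∀ z ∈ T.nearLocus N x (j + 1), IsClosed ({z} : Set (T.X (j + 1)))) ∧
        (∀ z ∈ T.nearLocus N x (j + 1), ∃ U : Set (T.X (j + 1)), IsOpen U ∧ U ∩ T.nearLocus N x (j + 1) = {z}) ∧
        ¬ (T.C j ⊆ (T.π j).base '' T.nearLocus N x (j + 1))) ∨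
      ((T.π j).base '' T.nearLocus N x (j + 1) = T.C j ∧
        Set.BijOn (T.π j).base (T.nearLocus N x (j + 1)) (T.C j) ∧
        IsClosed (T.nearLocus N x (j + 1)) ∧ IsIrreducible (T.nearLocus N x (j + 1)) ∧
        (T.nearLocus N x (j + 1)).Nontrivial ∧
        (∀ z ∈ T.nearLocus N x (j + 1), ¬ IsGenericPoint z (T.nearLocus N x (j + 1)) → IsClosed ({z} : Set (T.X (j + 1))))) := by
  by_cases hdom : η ∈ (T.π j).base '' T.nearLocus N x (j + 1)
  · exact Or.inr ⟨image_nearLocus_succ_eq_of_dominant T hkey hperm hcl hx (hNC j le_rfl) hη hdom,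
      bijOn_nearLocus_succ_of_dominant h314f hT36 h3104 hkey hperm hcl hx hchar hē hNC hCN hirr hnt hpts hη hdom, isClosed_nearLocus T hkey hperm hcl hx (j + 1),
      isIrreducible_nearLocus_succ_of_dominant h314f hT36 h3104 hkey hperm hcl hx hchar hē hNC hCN hirr hnt hpts hη hdom, nontrivial_nearLocus_succ_of_dominant h314f hT36 h3104 hkey hperm hcl hx hchar hē hNC hCN hirr hnt hpts hη hdom,
      isClosed_singleton_of_mem_nearLocus_succ_of_dominant h314f hT36 h3104 hkey hperm hcl hx hchar hē hNC hCN hirr hnt hpts hη hdom⟩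
  · exact Or.inl ⟨finite_nearLocus_succ_of_not_dominant h314f hT36 h3104 hkey hperm hcl hx hchar hē hNC hCN hirr hnt hpts hη hdom,
      isClosed_singleton_of_mem_nearLocus_succ_of_not_dominant h314f hT36 h3104 hkey hperm hcl hx hchar hē hNC hCN hirr hnt hpts hη hdom,
      exists_isOpen_inter_nearLocus_succ_eq_singleton_of_not_dominant h314f hT36 h3104 hkey hperm hcl hx hchar hē hNC hCN hirr hnt hpts hη hdom,
      not_subset_image_nearLocus_succ_of_not_dominant hη hdom⟩

/-- **If some point of `N_{j+1}(x)` is NOT isolated in it, the near locus DOMINATES `C_j`** (the form used along a unit: at an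
interior stage the marked point `x_{j+1} ∈ N_{j+1}(x)` is not isolated in its stratum). [cite: CossartJannsenSaito2020, Def. 6.38, p. 105] -/
theorem dominant_of_not_isolated [IsNoetherian (T.X 0)] (h314f : Thm314_nearFibre_subsingleton.{u})
    (hT36 : CossartJannsenSaito2020_thm_3_6.{u})
    (h3104 : CossartJannsenSaito2020_thm_3_10_4.{u}) (hkey : KeySetting T N)
    (hperm : ∀ j, IdealSheafData.IsPermissible (T.centreIdeal j))
    (hcl : ∀ (j : ℕ) (μ : ℕ → ℕ), IsClosed (Scheme.hsStratumGE (T.X j) N μ))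
    {x : T.X 0} (hx : IsClosed ({x} : Set (T.X 0))) (hchar : CharHypothesis (T.X 0) x) (hē : T.geomDirDimAt 0 x ≤ 2) {j : ℕ}
    (hNC : ∀ i, i ≤ j → T.nearLocus N x i ⊆ T.C i) (hCN : T.C j ⊆ T.nearLocus N x j)
    (hirr : IsIrreducible (T.C j)) (hnt : (T.C j).Nontrivial)
    (hpts : ∀ y ∈ T.C j, ¬ IsGenericPoint y (T.C j) → IsClosed ({y} : Set (T.X j)))
    {η : T.X j} (hη : IsGenericPoint η (T.C j)) {z : T.X (j + 1)} (hz : z ∈ T.nearLocus N x (j + 1))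
    (hniso : ¬ ∃ U : Set (T.X (j + 1)), IsOpen U ∧ U ∩ T.nearLocus N x (j + 1) = {z}) :
    η ∈ (T.π j).base '' T.nearLocus N x (j + 1) := by
  by_contra hdom
  exact hniso (exists_isOpen_inter_nearLocus_succ_eq_singleton_of_not_dominant h314f hT36 h3104 hkey hperm hcl hx hchar hē hNC hCN hirr hnt hpts hη hdom z hz)

/-! ## An ISOLATED closed near point forces the finite case (the end of a unit, CJS Def. 6.38 (v)) -/

/-- **A CLOSED point of `N_{j+1}(x)` which is ISOLATED in it rules out the dominant case** (in the dominant case `N_{j+1}(x)` is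
irreducible and nontrivial, so its generic point is not closed and lies in every open set meeting `N_{j+1}(x)`). The marked point of
a chain at an `Iso` stage is such a point. [cite: CossartJannsenSaito2020, Def. 6.38 (v), p. 105] -/
theorem not_dominant_of_isolated_closed (h314f : Thm314_nearFibre_subsingleton.{u})
    (hT36 : CossartJannsenSaito2020_thm_3_6.{u})
    (h3104 : CossartJannsenSaito2020_thm_3_10_4.{u}) (hkey : KeySetting T N)
    (hperm : ∀ j, IdealSheafData.IsPermissible (T.centreIdeal j))
    (hcl : ∀ (j : ℕ) (μ : ℕ → ℕ), IsClosed (Scheme.hsStratumGE (T.X j) N μ))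
    {x : T.X 0} (hx : IsClosed ({x} : Set (T.X 0))) (hchar : CharHypothesis (T.X 0) x) (hē : T.geomDirDimAt 0 x ≤ 2)
    {j : ℕ}
    (hNC : ∀ i, i ≤ j → T.nearLocus N x i ⊆ T.C i) (hCN : T.C j ⊆ T.nearLocus N x j)
    (hirr : IsIrreducible (T.C j)) (hnt : (T.C j).Nontrivial)
    (hpts : ∀ y ∈ T.C j, ¬ IsGenericPoint y (T.C j) → IsClosed ({y} : Set (T.X j)))
    {η : T.X j} (hη : IsGenericPoint η (T.C j)) {z : T.X (j + 1)} (hzcl : IsClosed ({z} : Set (T.X (j + 1))))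
    (hiso : ∃ U : Set (T.X (j + 1)), IsOpen U ∧ U ∩ T.nearLocus N x (j + 1) = {z}) :
    η ∉ (T.π j).base '' T.nearLocus N x (j + 1) := by
  intro hdom
  have hirr' := isIrreducible_nearLocus_succ_of_dominant h314f hT36 h3104 hkey hperm hcl hx hchar hē hNC hCN hirr hnt hpts hη hdom
  have hnt' := nontrivial_nearLocus_succ_of_dominant h314f hT36 h3104 hkey hperm hcl hx hchar hē hNC hCN hirr hnt hpts hη hdom
  have hN : IsClosed (T.nearLocus N x (j + 1)) := isClosed_nearLocus T hkey hperm hcl hx (j + 1)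
  have hζ : IsGenericPoint hirr'.genericPoint (T.nearLocus N x (j + 1)) := hirr'.isGenericPoint_genericPoint hN
  -- `z` is not the generic point: its closure is `{z}`, not the nontrivial `N_{j+1}(x)`
  have hne : hirr'.genericPoint ≠ z := by
    intro h
    have h1 : T.nearLocus N x (j + 1) = {z} := by rw [← hζ.def, h, hzcl.closure_eq]
    obtain ⟨w, hw, hwz⟩ := hnt'.exists_ne z
    exact hwz (by rw [h1] at hw; exact hw)
  -- but the generic point lies in the open `U` isolating `z`
  obtain ⟨U, hU, hUz⟩ := hiso
  have hζU : hirr'.genericPoint ∈ U :=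
    (hζ.mem_open_set_iff hU).mpr ⟨z, by rw [Set.inter_comm, hUz]; exact Set.mem_singleton z⟩
  have : hirr'.genericPoint ∈ U ∩ T.nearLocus N x (j + 1) := ⟨hζU, hζ.mem⟩
  rw [hUz] at this
  exact hne this

/-- **CJS Def. 6.38 (v) from an isolated closed near point**: if some closed point of `N_{j+1}(x)` is isolated in it (e.g. the marked
point at an `Iso` stage), then `π_{j+1} : N_{j+1}(x) → C_j` is NOT surjective. [cite: CossartJannsenSaito2020, Def. 6.38 (v), p. 105] -/
theorem not_subset_image_nearLocus_succ_of_isolated_closed (h314f : Thm314_nearFibre_subsingleton.{u})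
    (hT36 : CossartJannsenSaito2020_thm_3_6.{u})
    (h3104 : CossartJannsenSaito2020_thm_3_10_4.{u}) (hkey : KeySetting T N)
    (hperm : ∀ j, IdealSheafData.IsPermissible (T.centreIdeal j))
    (hcl : ∀ (j : ℕ) (μ : ℕ → ℕ), IsClosed (Scheme.hsStratumGE (T.X j) N μ))
    {x : T.X 0} (hx : IsClosed ({x} : Set (T.X 0))) (hchar : CharHypothesis (T.X 0) x) (hē : T.geomDirDimAt 0 x ≤ 2)
    {j : ℕ}
    (hNC : ∀ i, i ≤ j → T.nearLocus N x i ⊆ T.C i) (hCN : T.C j ⊆ T.nearLocus N x j)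
    (hirr : IsIrreducible (T.C j)) (hnt : (T.C j).Nontrivial)
    (hpts : ∀ y ∈ T.C j, ¬ IsGenericPoint y (T.C j) → IsClosed ({y} : Set (T.X j)))
    {z : T.X (j + 1)} (hzcl : IsClosed ({z} : Set (T.X (j + 1))))
    (hiso : ∃ U : Set (T.X (j + 1)), IsOpen U ∧ U ∩ T.nearLocus N x (j + 1) = {z}) :
    ¬ (T.C j ⊆ (T.π j).base '' T.nearLocus N x (j + 1)) :=
  have hη : IsGenericPoint hirr.genericPoint (T.C j) := hirr.isGenericPoint_genericPoint (T.isClosed_C j)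
  not_subset_image_nearLocus_succ_of_not_dominant hη
    (not_dominant_of_isolated_closed h314f hT36 h3104 hkey hperm hcl hx hchar hē hNC hCN hirr hnt hpts hη hzcl hiso)

/-! ## Along a tower whose centres ARE the near loci: the curve data propagate, and (iv) of Def. 6.38 holds at every step -/

/-- Transport of `InducesIsoOn` along an equality of the source closed set (the closedness proofs are irrelevant). [folklore] -/
theorem _root_.Literature.AlgebraicGeometry.CossartJannsenSaito2020.InducesIsoOn.of_eq {Y' Y : Scheme.{u}} {π : Y' ⟶ Y}
    {C₁ C₁' : Set Y'} (h : C₁ = C₁') {h₁ : IsClosed C₁} {h₁' : IsClosed C₁'} {C : Set Y} {hC : IsClosed C}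
    (hI : InducesIsoOn π C₁ h₁ C hC) : InducesIsoOn π C₁' h₁' C hC := by
  subst h; exact hI

/-- **THE CURVE DATA PROPAGATE along a tower whose centres are the near loci.** If `C_0 = {x}`, `C_i = N_i(x)` for `1 ≤ i ≤ q`,
`C_1` is an irreducible positive-dimensional set with closed non-generic points (`ℙ(Dir_x) ≅ ℙ¹`, (R1)/P-a), and at every stage
`2 ≤ i ≤ q` some CLOSED point of `N_i(x)` is NOT isolated in it (the marked point at a non-`Iso` stage), then EVERY `C_i`
(`1 ≤ i ≤ q`) is irreducible, nontrivial, with closed non-generic points — so the one-step theorems apply at every stage `≤ q`.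
[cite: CossartJannsenSaito2020, Def. 6.38 (iii)–(iv), p. 104] -/
theorem curveData_of_centres_eq_nearLocus [IsNoetherian (T.X 0)] (h314f : Thm314_nearFibre_subsingleton.{u})
    (hT36 : CossartJannsenSaito2020_thm_3_6.{u})
    (h3104 : CossartJannsenSaito2020_thm_3_10_4.{u}) (hkey : KeySetting T N)
    (hperm : ∀ j, IdealSheafData.IsPermissible (T.centreIdeal j))
    (hcl : ∀ (j : ℕ) (μ : ℕ → ℕ), IsClosed (Scheme.hsStratumGE (T.X j) N μ))
    {x : T.X 0} (hx : IsClosed ({x} : Set (T.X 0))) (hchar : CharHypothesis (T.X 0) x) (hē : T.geomDirDimAt 0 x ≤ 2)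
    (hC0 : T.C 0 = {x}) {q : ℕ} (hCq : ∀ i, 1 ≤ i → i ≤ q → T.C i = T.nearLocus N x i)
    (h1irr : IsIrreducible (T.C 1)) (h1nt : (T.C 1).Nontrivial)
    (h1pts : ∀ y ∈ T.C 1, ¬ IsGenericPoint y (T.C 1) → IsClosed ({y} : Set (T.X 1)))
    (hniso : ∀ i, 2 ≤ i → i ≤ q → ∃ z ∈ T.nearLocus N x i, IsClosed ({z} : Set (T.X i)) ∧
      ¬ ∃ U : Set (T.X i), IsOpen U ∧ U ∩ T.nearLocus N x i = {z}) :
    ∀ i, 1 ≤ i → i ≤ q → IsIrreducible (T.C i) ∧ (T.C i).Nontrivial ∧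
      (∀ y ∈ T.C i, ¬ IsGenericPoint y (T.C i) → IsClosed ({y} : Set (T.X i))) := by
  -- `N_i ⊆ C_i` for all `i ≤ q`
  have hNC : ∀ i, i ≤ q → T.nearLocus N x i ⊆ T.C i := by
    intro i hi
    rcases Nat.eq_zero_or_pos i with rfl | hpos
    · rw [BlowupTower.nearLocus_zero, hC0]
    · exact (hCq i hpos hi).symm.subset
  intro i
  induction i with
  | zero => intro h; exact absurd h (by omega)
  | succ i ih =>
    intro _ hiq
    rcases Nat.eq_zero_or_pos i with rfl | hpos
    · exact ⟨h1irr, h1nt, h1pts⟩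
    · obtain ⟨hirr, hnt, hpts⟩ := ih hpos (by omega)
      have hCN : T.C i ⊆ T.nearLocus N x i := (hCq i hpos (by omega)).subset
      have hNC' : ∀ k, k ≤ i → T.nearLocus N x k ⊆ T.C k := fun k hk => hNC k (by omega)
      have hη : IsGenericPoint hirr.genericPoint (T.C i) := hirr.isGenericPoint_genericPoint (T.isClosed_C i)
      obtain ⟨z, hz, hzcl, hzniso⟩ := hniso (i + 1) (by omega) hiq
      have hdom : hirr.genericPoint ∈ (T.π i).base '' T.nearLocus N x (i + 1) := by
        by_contra hfin
        exact hzniso (exists_isOpen_inter_nearLocus_succ_eq_singleton_of_not_dominant h314f hT36 h3104 hkey hperm hcl hx hchar hē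
          hNC' hCN hirr hnt hpts hη hfin z hz)
      rw [hCq (i + 1) (by omega) hiq]
      exact ⟨isIrreducible_nearLocus_succ_of_dominant h314f hT36 h3104 hkey hperm hcl hx hchar hē hNC' hCN hirr hnt hpts hη hdom,
        nontrivial_nearLocus_succ_of_dominant h314f hT36 h3104 hkey hperm hcl hx hchar hē hNC' hCN hirr hnt hpts hη hdom,
        isClosed_singleton_of_mem_nearLocus_succ_of_dominant h314f hT36 h3104 hkey hperm hcl hx hchar hē hNC' hCN hirr hnt hpts
          hη hdom⟩

/-- **CJS Def. 6.38 (iv) ALONG THE UNIT: `π_{j+1}` induces an isomorphism `C_{j+1} ⥲ C_j` for `1 ≤ j`, `j + 1 ≤ q`** — the `iso`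
clause of `IsFundamentalUnit` / stub-1's `Seg.UnitCentreDiscipline`, for a tower whose centres are the near loci up to stage `q`
(hypotheses of `curveData_of_centres_eq_nearLocus`; binders `hPb`, `h314`). [cite: CossartJannsenSaito2020, Def. 6.38 (iv), p. 104] -/
theorem inducesIsoOn_of_centres_eq_nearLocus [IsNoetherian (T.X 0)]
    (hPb : ∀ (X X' : Scheme.{u}) [IsLocallyNoetherian X] [IsLocallyNoetherian X'] (π : X' ⟶ X) (D : X.IdealSheafData),
      Scheme.IsExcellent X → IdealSheafData.IsPermissible D → IsBlowup π D →
      ∀ N : ℕ, topologicalKrullDim ↥X ≤ (N : WithBot ℕ∞) →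
      ∀ x' : X', π.base x' ∈ D.support → stalkIdeal D (π.base x') = maximalIdeal _ →
        CharHypothesis X (π.base x') → Scheme.dirDim X (π.base x') = 1 →
        Scheme.hsFun X' N x' = Scheme.hsFun X N (π.base x') → IsIso (π.residueFieldMap x'))
    (h314 : CossartJannsenSaito2020_thm_3_14.{u}) (h314f : Thm314_nearFibre_subsingleton.{u})
    (hT36 : CossartJannsenSaito2020_thm_3_6.{u})
    (h3104 : CossartJannsenSaito2020_thm_3_10_4.{u}) (hkey : KeySetting T N)
    (hperm : ∀ j, IdealSheafData.IsPermissible (T.centreIdeal j))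
    (hcl : ∀ (j : ℕ) (μ : ℕ → ℕ), IsClosed (Scheme.hsStratumGE (T.X j) N μ))
    {x : T.X 0} (hx : IsClosed ({x} : Set (T.X 0))) (hchar : CharHypothesis (T.X 0) x) (hē : T.geomDirDimAt 0 x ≤ 2)
    (hC0 : T.C 0 = {x}) {q : ℕ} (hCq : ∀ i, 1 ≤ i → i ≤ q → T.C i = T.nearLocus N x i)
    (h1irr : IsIrreducible (T.C 1)) (h1nt : (T.C 1).Nontrivial)
    (h1pts : ∀ y ∈ T.C 1, ¬ IsGenericPoint y (T.C 1) → IsClosed ({y} : Set (T.X 1)))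
    (hniso : ∀ i, 2 ≤ i → i ≤ q → ∃ z ∈ T.nearLocus N x i, IsClosed ({z} : Set (T.X i)) ∧
      ¬ ∃ U : Set (T.X i), IsOpen U ∧ U ∩ T.nearLocus N x i = {z}) :
    ∀ j, 1 ≤ j → j + 1 ≤ q → InducesIsoOn (T.π j) (T.C (j + 1)) (T.isClosed_C (j + 1)) (T.C j) (T.isClosed_C j) := by
  intro j hj hjq
  have hNC : ∀ k, k ≤ j → T.nearLocus N x k ⊆ T.C k := by
    intro k hk
    rcases Nat.eq_zero_or_pos k with rfl | hpos
    · rw [BlowupTower.nearLocus_zero, hC0]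
    · exact (hCq k hpos (by omega)).symm.subset
  obtain ⟨hirr, hnt, hpts⟩ :=
    curveData_of_centres_eq_nearLocus h314f hT36 h3104 hkey hperm hcl hx hchar hē hC0 hCq h1irr h1nt h1pts hniso j hj (by omega)
  have hCN : T.C j ⊆ T.nearLocus N x j := (hCq j hj (by omega)).subset
  have hη : IsGenericPoint hirr.genericPoint (T.C j) := hirr.isGenericPoint_genericPoint (T.isClosed_C j)
  obtain ⟨z, hz, hzcl, hzniso⟩ := hniso (j + 1) (by omega) hjq
  have hdom : hirr.genericPoint ∈ (T.π j).base '' T.nearLocus N x (j + 1) := by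
    by_contra hfin
    exact hzniso (exists_isOpen_inter_nearLocus_succ_eq_singleton_of_not_dominant h314f hT36 h3104 hkey hperm hcl hx hchar hē
      hNC hCN hirr hnt hpts hη hfin z hz)
  exact (inducesIsoOn_nearLocus_succ_of_dominant hPb h314 h314f hT36 h3104 hkey hperm hcl hx hchar hē hNC hCN hirr hnt hpts hη hdom
    (isClosed_nearLocus T hkey hperm hcl hx (j + 1))).of_eq (hCq (j + 1) (by omega) hjq).symm

end BlowupTowerNear

end Summit.ResolutionOfSingularities.ResolutionOfSingularities.Theorems.SigmaMaxModificationsCorridor3.Helpers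

end
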